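import Literature.NumberTheory.EllipticCurves.J1728MulI
import Literature.NumberTheory.ComplexMultiplication.ShimuraTaniyamaHecke
import Literature.AlgebraicGeometry.ComplexMultiplication.ShimuraIsogenyCyclotomicHolds
import Literature.AlgebraicGeometry.Milne1999.CodesHCOfCMHodgeHypothesis
import Mathlib.NumberTheory.NumberField.CMField
import Mathlib.FieldTheory.IsAlgClosed.Basic
import HarnessLib

/-!
# A structure of type `(K, Φ)` defined over a number field: `y² = x³ + x` with `[i]` over `ℚ(ζ₄)`

Topic `Literature/NumberTheory/ComplexMultiplication` (namespace `Literature.NumberTheory.ComplexMultiplication`,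
sub-namespace `GaussianCMCurve`).  NON-VACUITY of the carrier `IsCMTypeRealisationOver Φ A₀ ι₀`
(`NumberTheory/ComplexMultiplication/ShimuraTaniyamaHecke`: "a structure `(A, ι)` of type `(K, Φ)`
defined over `k ⊆ ℂ`", Shimura 1998 §19.7 / Serre–Tate 1968 §4) on which the four Shimura–Taniyama
records of that file rest — lane `lit-hodgefound`, Layer-B validation row V-B19 (TRIBUNAL-B v2, probe
`TribunalB2.exists_isCMTypeRealisationOver_req`, verbatim below as `exists_isCMTypeRealisationOver`).

THE INSTANCE (Silverman, *The Arithmetic of Elliptic Curves*, III.4 Example 4.4, held PDF p. 70; Shimura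
1998 §5.2 for "type `(K; Φ)`"): `k = K = ℚ(ζ₄) = ℚ(i)` (`CyclotomicField 4 ℚ`, a CM field), embedded in `ℂ`
by a (chosen) field embedding; `A₀ = E : y² = x³ + x` over `k` as an abelian variety ON THE TREE'S REAL
CARRIER (the plane cubic with the chord–tangent group law, `EllipticCurves.J1728.abelianVariety`);
`ι₀ : ℤ[ζ₄] = 𝓞_K → End_k(E)`, `ζ₄ ↦ [i]`, `[i] : (x, y) ↦ (-x, iy)` DEFINED OVER `k`
(`EllipticCurves.J1728.mulI`, `[i] ≫ [i] = -𝟙`; Silverman: «There is thus a ring homomorphism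
`ℤ[i] → End(E)`»).  That `(E ⊗_k ℂ, ι₀ ⊗ ℂ)` realises SOME CM type `Φ` of `K` read on `H¹(E(ℂ); ℂ)` is the
tree THEOREM `ComplexMultiplication.CyclotomicPair.exists_isCMTypeRealisation` (Shimura §5.2: a complex
abelian variety `A` with `Φₘ(u) = 0`, `2 dim A = φ(m)`, is of type `(ℚ(ζₘ); Φ_u)` — from the Hodge
decomposition of `H¹`, `CMTypeDictionary.isCMTypeRealisation_cmTypeOfPair`) applied to `u = [i] ⊗ ℂ`
(`Φ₄(u) = u² + 1 = 0` because base change of endomorphisms is a ring homomorphism,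
`AbelianVariety.endBaseChange`; `dim (E ⊗ ℂ) = dim E = 1`, `AbelianVariety.dim_baseChange`), and
`ι ⊗ ℂ = ι_u` because both send `ζ₄ ↦ u` (`𝓞_K = ℤ[ζ₄]`, Mathlib `IsPrimitiveRoot.integralPowerBasis`).
Which of the two CM types of `ℚ(i)` is realised depends on the chosen embedding `k → ℂ` and is not
asserted.

* `GaussianCMCurve.embedding : ℚ(ζ₄) →+* ℂ`, `GaussianCMCurve.algebraComplex` (local instance);
* `GaussianCMCurve.zeta_sq : ζ₄² = -1`; `GaussianCMCurve.iota₀ : 𝓞 ℚ(ζ₄) →+* End E`, `iota₀_toInteger_zeta`;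
* `GaussianCMCurve.exists_isCMTypeRealisationOver_iota₀ : ∃ Φ, IsCMTypeRealisationOver Φ E ι₀`;
* `exists_isCMTypeRealisationOver` — V-B19 verbatim: `∃ k K Φ A₀ ι₀, IsCMTypeRealisationOver Φ A₀ ι₀` with
  `k`, `K` number fields, `K` CM;
* corollaries (étale form of CM type, Milne 1999 p. 54, via the tree theorem
  `IsCMTypeRealisation.isOfCMType`): `GaussianCMCurve.isOfCMType_baseChange` (`E ⊗_k ℂ` is of CM type),
  `GaussianCMCurve.isOfCMType_complex` (the complex curve `y² = x³ + x` with `[i]`, `i = √-1 ∈ ℂ`, is of CM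
  type) and `exists_isOfCMType_dim_eq_one : ∃ A : AbelianVariety ℂ, A.dim = 1 ∧ IsOfCMType A` — a
  POSITIVE-dimensional Literature-side instance of `Milne1999.IsOfCMType` (the bare `∃ A, IsOfCMType A` of
  probe `exists_isOfCMType_req` is met already by the zero abelian variety, `isOfCMType_of_dim_eq_zero`).

Everything is a definition with a body or a theorem; no named fact (D-0026); axioms standard.  The
`Fact (IsUnit 2)` and `Algebra ℚ(ζ₄) ℂ` instances are LOCAL (carried by the statements as explicit terms).

## References

* [SilvermanAEC2009] J. H. Silverman, *The Arithmetic of Elliptic Curves*, 2nd ed. (2009), III.4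
  Example 4.4 (p. 70 of the held copy), III.10.1.
* [Shimura1998] G. Shimura, *Abelian Varieties with Complex Multiplication and Modular Functions* (1998),
  §5.2 (type `(F; {φᵢ})`), §19.7 (structures of type `(K, Φ)` over `k`).
* [SerreTate1968] J.-P. Serre, J. Tate, *Good reduction of abelian varieties*, Ann. of Math. 88 (1968), §4.
* [Milne1999] J. S. Milne, *Lefschetz motives and the Tate conjecture*, Compositio Math. 117 (1999), §2 p. 54.
-/

noncomputable section

open Polynomial NumberField CategoryTheory IsCyclotomicExtension
open Literature.AlgebraicGeometry.Motives (AbelianVariety CMType)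
open Literature.AlgebraicGeometry.ComplexMultiplication (IsCMTypeRealisation complexAction
  CyclotomicPair.exists_isCMTypeRealisation)
open Literature.NumberTheory.EllipticCurves

namespace Literature.NumberTheory.ComplexMultiplication

namespace GaussianCMCurve

/-! ### The field `k = K = ℚ(ζ₄)` and its embedding into `ℂ` -/

/-- `ℚ(ζ₄) = ℚ(i)` as Mathlib's `CyclotomicField 4 ℚ`. -/
local notation "K₄" => CyclotomicField 4 ℚ

/-- `ℚ(ζ₄)/ℚ` is the cyclotomic extension for `S = {4}` (Mathlib's instance
`CyclotomicField.isCyclotomicExtension`, registered LOCALLY for the literal `4`, which instance search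
does not find on its own). [folklore] -/
private theorem isCyclotomicExtension_four : IsCyclotomicExtension {4} ℚ K₄ :=
  CyclotomicField.isCyclotomicExtension 4 ℚ

attribute [local instance] isCyclotomicExtension_four

/-- A field embedding `ℚ(ζ₄) → ℂ` (any of the two; Mathlib's `IsAlgClosed.lift`), through which
`k = ℚ(ζ₄)` is regarded as a subfield of `ℂ` (Shimura 19.7: "`k ⊆ ℂ`"). [cite: Shimura1998, §19.7] -/
def embedding : K₄ →+* ℂ := (IsAlgClosed.lift : K₄ →ₐ[ℚ] ℂ).toRingHom

/-- `ℂ` as a `ℚ(ζ₄)`-algebra through `embedding` (a LOCAL instance: the existential statement below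
carries it as an explicit witness). [folklore] -/
abbrev algebraComplex : Algebra K₄ ℂ := (embedding).toAlgebra

attribute [local instance] algebraComplex

/-- `2` is a unit of `ℚ(ζ₄)` (characteristic zero), so that `y² = x³ + x` is elliptic (`Δ = -64`);
a LOCAL instance. [folklore] -/
private theorem fact_isUnit_two : Fact (IsUnit (2 : K₄)) := ⟨isUnit_iff_ne_zero.mpr two_ne_zero⟩

attribute [local instance] fact_isUnit_two

/-- The chosen primitive fourth root of unity `ζ₄ ∈ ℚ(ζ₄)` («let `i` be a primitive fourth root of
unity, i.e. `i² = -1`»). [cite: SilvermanAEC2009, III.4 Example 4.4] -/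
theorem isPrimitiveRoot_zeta : IsPrimitiveRoot (zeta 4 ℚ K₄) 4 := zeta_spec 4 ℚ K₄

/-- **`ζ₄² = -1`** (`ζ₄²` is a primitive square root of unity). [cite: SilvermanAEC2009, III.4 Example 4.4] -/
theorem zeta_sq : (zeta 4 ℚ K₄) ^ 2 = -1 :=
  (isPrimitiveRoot_zeta.pow (by norm_num) (show 4 = 2 * 2 by norm_num)).eq_neg_one_of_two_right

/-- `ℚ(ζ₄)` is a CM field (Mathlib: a cyclotomic field `ℚ(ζₙ)`, `n > 2`, is CM). [folklore] -/
instance isCMField : IsCMField K₄ := IsCyclotomicExtension.Rat.isCMField K₄ (S := ({4} : Set ℕ)) ⟨4, rfl, by norm_num⟩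

/-! ### `ι₀ : 𝓞_K = ℤ[ζ₄] → End_k(E)`, `ζ₄ ↦ [i]` -/

/-- The minimal polynomial over `ℤ` of the generator `ζ ∈ 𝓞_K` of Mathlib's integral power basis of a
cyclotomic field `K = ℚ(ζ₄)` is `Φ₄` (`𝓞_K = ℤ[ζ₄]`, `cyclotomic_eq_minpoly`; stated for any model `K` of
`ℚ(ζ₄)` so that the generic `ℤ`-algebra structure of `K` is used). [folklore] -/
private theorem minpoly_integralPowerBasis_gen {K : Type} [Field K] [NumberField K]
    [IsCyclotomicExtension {4} ℚ K] {ζ : K} (hζ : IsPrimitiveRoot ζ 4) :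
    minpoly ℤ hζ.integralPowerBasis.gen = cyclotomic 4 ℤ := by
  rw [IsPrimitiveRoot.integralPowerBasis_gen]
  have h1 : minpoly ℤ hζ.toInteger = minpoly ℤ (algebraMap (𝓞 K) K hζ.toInteger) :=
    (minpoly.algebraMap_eq (A := ℤ) (B := 𝓞 K) (B' := K) RingOfIntegers.coe_injective hζ.toInteger).symm
  rw [h1]
  exact (cyclotomic_eq_minpoly hζ (by norm_num)).symm

/-- A ring homomorphism as a `ℤ`-algebra homomorphism, for ARBITRARY `ℤ`-algebra structures on source and
target (the endomorphism rings `End A` carry the `ℤ`-linear-category one; every ring map commutes with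
the integer casts). [folklore] -/
private def toIntAlgHom' {R S : Type*} [Ring R] [Ring S] [Algebra ℤ R] [Algebra ℤ S] (f : R →+* S) :
    R →ₐ[ℤ] S :=
  { f with commutes' := fun n => by simp only [eq_intCast, RingHom.toMonoidHom_eq_coe,
      OneHom.toFun_eq_coe, MonoidHom.toOneHom_coe, MonoidHom.coe_coe, map_intCast] }

/-- `toIntAlgHom' f a = f a`. [folklore] -/
@[simp] private theorem toIntAlgHom'_apply {R S : Type*} [Ring R] [Ring S] [Algebra ℤ R] [Algebra ℤ S]
    (f : R →+* S) (a : R) : toIntAlgHom' f a = f a := rfl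

/-- `Φ₄ = X² + 1` over `ℤ`. [folklore] -/
private theorem cyclotomic_four : cyclotomic 4 ℤ = X ^ 2 + 1 := by
  rw [show (4 : ℕ) = 2 ^ (1 + 1) by norm_num, cyclotomic_prime_pow_eq_geom_sum Nat.prime_two]
  simp [Finset.sum_range_succ, add_comm]

/-- `Φ₄([i]) = 0` in `End_k(E)` for `E : y² = x³ + x` over `k = ℚ(ζ₄)` and `[i] = [ζ₄]`
(`[i]² + 1 = 0`, `EllipticCurves.J1728.aeval_mulI_X_sq_add_one`). [cite: SilvermanAEC2009, III.4 Example 4.4] -/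
theorem aeval_mulI_cyclotomic_four :
    aeval (R := ℤ) (show End (J1728.abelianVariety K₄) from J1728.mulI zeta_sq) (cyclotomic 4 ℤ) = 0 := by
  rw [cyclotomic_four]
  exact J1728.aeval_mulI_X_sq_add_one zeta_sq

/-- **`ι₀ : 𝓞_K = ℤ[ζ₄] → End_k(E)`, `ζ₄ ↦ [i]`** — the `ℤ[i]`-structure of `E : y² = x³ + x` over
`k = ℚ(ζ₄)` (Silverman: «There is thus a ring homomorphism `ℤ[i] → End(E)`, `m + ni ↦ [m] + [n] ∘ [i]`»;
Mathlib's `PowerBasis.lift` along the integral power basis of `ζ₄`, legitimate because `Φ₄([i]) = 0`).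
[cite: SilvermanAEC2009, III.4 Example 4.4] -/
def iota₀ : 𝓞 K₄ →+* End (J1728.abelianVariety K₄) :=
  (isPrimitiveRoot_zeta.integralPowerBasis.lift (show End (J1728.abelianVariety K₄) from J1728.mulI zeta_sq)
    (by rw [minpoly_integralPowerBasis_gen isPrimitiveRoot_zeta]; exact aeval_mulI_cyclotomic_four)).toRingHom

/-- `ι₀(ζ₄) = [i]`. [cite: SilvermanAEC2009, III.4 Example 4.4] -/
theorem iota₀_toInteger_zeta : iota₀ isPrimitiveRoot_zeta.toInteger = J1728.mulI zeta_sq := by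
  have h : iota₀ isPrimitiveRoot_zeta.integralPowerBasis.gen = J1728.mulI zeta_sq :=
    PowerBasis.lift_gen isPrimitiveRoot_zeta.integralPowerBasis _ _
  rwa [IsPrimitiveRoot.integralPowerBasis_gen] at h

/-! ### The realisation over `ℚ(ζ₄)` -/

/-- `Φ₄([i] ⊗ ℂ) = 0` in `End(E ⊗_k ℂ)`: base change of endomorphisms `End_k(E) → End(E ⊗ ℂ)` is a ring
homomorphism (`AbelianVariety.endBaseChange`). [cite: Shimura1998, §5.2] -/
theorem aeval_baseChange_mulI_cyclotomic_four :
    aeval (R := ℤ) (show End ((J1728.abelianVariety K₄).baseChange ℂ) from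
      (J1728.abelianVariety K₄).endBaseChange ℂ (J1728.mulI zeta_sq)) (cyclotomic 4 ℤ) = 0 := by
  rw [aeval_def, RingHom.ext_int (algebraMap ℤ (End ((J1728.abelianVariety K₄).baseChange ℂ)))
    (((J1728.abelianVariety K₄).endBaseChange ℂ).comp (algebraMap ℤ (End (J1728.abelianVariety K₄)))),
    ← hom_eval₂, ← aeval_def, aeval_mulI_cyclotomic_four, map_zero]

/-- `2 · dim (E ⊗_k ℂ) = φ(4)` (`dim (E ⊗ ℂ) = dim E = 1`, `φ(4) = 2 = [ℚ(ζ₄) : ℚ]`). [cite: Shimura1998, §5.2] -/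
theorem two_mul_dim_baseChange : 2 * ((J1728.abelianVariety K₄).baseChange ℂ).dim = Nat.totient 4 := by
  rw [AbelianVariety.dim_baseChange, J1728.dim_abelianVariety]
  decide

/-- **`(E, ι₀)` over `k = ℚ(ζ₄)` is a structure of type `(ℚ(ζ₄), Φ)` for some CM type `Φ`**:
`(E ⊗_k ℂ, ι₀ ⊗ ℂ)` realises a CM type of `K = ℚ(ζ₄)` read on `H¹(E(ℂ); ℂ)` — Shimura §5.2 for the complex
abelian variety `E ⊗ ℂ` with `Φ₄([i] ⊗ ℂ) = 0`, `2 dim = φ(4)` (the tree theorem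
`CyclotomicPair.exists_isCMTypeRealisation`), the `𝓞_K`-action `ι ⊗ ℂ` being the principal one `ι_u`
(`u = [i] ⊗ ℂ`) because both send `ζ₄ ↦ u` and `𝓞_K = ℤ[ζ₄]`.  Which of the two CM types of `ℚ(i)` occurs
depends on the embedding `k → ℂ` and is not asserted. [cite: Shimura1998, §5.2 and §19.7]
[cite: SilvermanAEC2009, III.4 Example 4.4] -/
theorem exists_isCMTypeRealisationOver_iota₀ :
    ∃ Φ : CMType K₄, IsCMTypeRealisationOver Φ (J1728.abelianVariety K₄) iota₀ := by
  obtain ⟨ι, φ, Φ, hιζ, hreal, -⟩ := CyclotomicPair.exists_isCMTypeRealisation (K := K₄)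
    (A := (J1728.abelianVariety K₄).baseChange ℂ) isPrimitiveRoot_zeta
    aeval_baseChange_mulI_cyclotomic_four two_mul_dim_baseChange
  refine ⟨Φ, complexAction φ, ?_⟩
  -- `ι ⊗ ℂ` and `ι_u` are two ring maps out of `𝓞_K = ℤ[ζ₄]` agreeing at `ζ₄`
  have hcomp : ((J1728.abelianVariety K₄).endBaseChange ℂ).comp iota₀ = ι := by
    have h : toIntAlgHom' (((J1728.abelianVariety K₄).endBaseChange ℂ).comp iota₀) = toIntAlgHom' ι := by
      refine isPrimitiveRoot_zeta.integralPowerBasis.algHom_ext ?_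
      rw [IsPrimitiveRoot.integralPowerBasis_gen, toIntAlgHom'_apply, toIntAlgHom'_apply,
        RingHom.comp_apply, iota₀_toInteger_zeta, hιζ, AbelianVariety.endBaseChange_apply]
    exact RingHom.ext fun a => congrArg (fun f : 𝓞 K₄ →ₐ[ℤ] _ => f a) h
  rw [hcomp]
  exact hreal

/-! ### Corollaries: `E ⊗ ℂ` and the complex curve `y² = x³ + x` are of CM type (étale form) -/

open Literature.AlgebraicGeometry.Milne1999 (IsOfCMType)

/-- **`E ⊗_k ℂ` is of CM type** (Milne 1999 p. 54, étale form `Milne1999.IsOfCMType`: `End⁰` contains a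
commutative reduced `ℚ`-subalgebra of degree `2 dim`, here `ℚ(ι₀(𝓞_K)) ≅ ℚ(i)`), by the tree theorem
`IsCMTypeRealisation.isOfCMType`. [cite: Milne1999, §2 p. 54] [cite: SilvermanAEC2009, III.4 Example 4.4] -/
theorem isOfCMType_baseChange : IsOfCMType ((J1728.abelianVariety K₄).baseChange ℂ) := by
  obtain ⟨Φ, θ, h⟩ := exists_isCMTypeRealisationOver_iota₀
  exact h.isOfCMType

/-- `2` is a unit of `ℂ`; a LOCAL instance (so that `y² = x³ + x` over `ℂ` is elliptic). [folklore] -/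
private theorem fact_isUnit_two_complex : Fact (IsUnit (2 : ℂ)) := ⟨isUnit_iff_ne_zero.mpr two_ne_zero⟩

attribute [local instance] fact_isUnit_two_complex

/-- `Φ₄([i]) = 0` in `End(E_ℂ)` for the COMPLEX curve `E_ℂ : y² = x³ + x` and `[i] = [√-1]`, `√-1 = Complex.I`.
[cite: SilvermanAEC2009, III.4 Example 4.4] -/
theorem aeval_mulI_complex_cyclotomic_four :
    aeval (R := ℤ) (show End (J1728.abelianVariety ℂ) from J1728.mulI Complex.I_sq) (cyclotomic 4 ℤ) = 0 := by
  rw [cyclotomic_four]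
  exact J1728.aeval_mulI_X_sq_add_one Complex.I_sq

/-- **The complex elliptic curve `y² = x³ + x` is of CM type** (étale form; Silverman: «Thus `E` has complex
multiplication»): `([i] : E_ℂ ⟶ E_ℂ)` with `Φ₄([i]) = 0`, `2 dim E_ℂ = φ(4)`, realises a CM type of `ℚ(ζ₄)` on
`H¹` (`CyclotomicPair.exists_isCMTypeRealisation`), hence `End⁰(E_ℂ) ⊇ ℚ(i)` of degree `2 = 2 dim`.
[cite: SilvermanAEC2009, III.4 Example 4.4] [cite: Milne1999, §2 p. 54] -/
theorem isOfCMType_complex : IsOfCMType (J1728.abelianVariety ℂ) := by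
  obtain ⟨ι, φ, Φ, -, hreal, -⟩ := CyclotomicPair.exists_isCMTypeRealisation (K := K₄)
    (A := J1728.abelianVariety ℂ) isPrimitiveRoot_zeta aeval_mulI_complex_cyclotomic_four
    (by rw [J1728.dim_abelianVariety]; decide)
  exact hreal.isOfCMType

end GaussianCMCurve

/-- **A one-dimensional complex abelian variety of CM type exists on the tree's carrier** (`y² = x³ + x`
with `[i]`; a positive-dimensional Literature-side instance of `Milne1999.IsOfCMType`, cf. the TRIBUNAL-B
probe `exists_isOfCMType_req`, whose bare form `∃ A, IsOfCMType A` the zero abelian variety already meets).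
[cite: SilvermanAEC2009, III.4 Example 4.4] [cite: Milne1999, §2 p. 54] -/
theorem exists_isOfCMType_dim_eq_one :
    ∃ A : AbelianVariety ℂ, A.dim = 1 ∧ Literature.AlgebraicGeometry.Milne1999.IsOfCMType A :=
  letI : Fact (IsUnit (2 : ℂ)) := ⟨isUnit_iff_ne_zero.mpr two_ne_zero⟩
  ⟨J1728.abelianVariety ℂ, J1728.dim_abelianVariety ℂ, GaussianCMCurve.isOfCMType_complex⟩

/-- **A structure `(A₀, ι₀)` of type `(K, Φ)` defined over a number field EXISTS on the tree's carrier**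
(Layer-B validation row V-B19 = TRIBUNAL-B probe `exists_isCMTypeRealisationOver_req`, verbatim): `k = K =
ℚ(ζ₄)` (a CM field) embedded in `ℂ`, `A₀ = E : y² = x³ + x` over `k` with its chord–tangent group law,
`ι₀ : ℤ[ζ₄] → End_k(E)`, `ζ₄ ↦ [i] = ((x, y) ↦ (-x, iy))` (Silverman III.4 Example 4.4), realising a CM type
`Φ` of `ℚ(ζ₄)` on `H¹(E(ℂ); ℂ)` (Shimura §5.2, §19.7).  Hence the hypotheses `IsCMTypeRealisationOver Φ A₀ ι₀`
of the Shimura–Taniyama records of `ShimuraTaniyamaHecke` / `ShimuraTaniyamaFormula` are not vacuous.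
[cite: Shimura1998, §19.7] [cite: SilvermanAEC2009, III.4 Example 4.4] -/
theorem exists_isCMTypeRealisationOver :
    ∃ (k : Type) (_ : Field k) (_ : NumberField k) (_ : Algebra k ℂ) (K : Type) (_ : Field K)
      (_ : NumberField K) (_ : IsCMField K) (Φ : CMType K) (A₀ : AbelianVariety k)
      (ι₀ : 𝓞 K →+* End A₀), IsCMTypeRealisationOver Φ A₀ ι₀ := by
  letI : Algebra (CyclotomicField 4 ℚ) ℂ := GaussianCMCurve.algebraComplex
  letI : Fact (IsUnit (2 : CyclotomicField 4 ℚ)) := ⟨isUnit_iff_ne_zero.mpr two_ne_zero⟩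
  obtain ⟨Φ, hΦ⟩ := GaussianCMCurve.exists_isCMTypeRealisationOver_iota₀
  exact ⟨CyclotomicField 4 ℚ, inferInstance, inferInstance, GaussianCMCurve.algebraComplex,
    CyclotomicField 4 ℚ, inferInstance, inferInstance, GaussianCMCurve.isCMField, Φ,
    J1728.abelianVariety (CyclotomicField 4 ℚ), GaussianCMCurve.iota₀, hΦ⟩

end Literature.NumberTheory.ComplexMultiplication

end
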